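import Mathlib
import HarnessLib
import Summits.NavierStokesRegularity.NavierStokesRegularity.Theorems.PoloidalWindowDoorLrcModEntireJetCertDefs

/-!
# Route `PoloidalWindowDoor`, item `LrcModEntire` (stmt-NavierStokesRegularity-20428) — the certificate checker with MASKED
# derivative tables (truncated jets) and a single Boolean check

Cell ns-regularity-ideate, seat ns-poloidal-K2-p3 gen 7 (lead of item 20428; `--supports stmt-NavierStokesRegularity-20428`; definitions reviewed).
Sequel of `…PoloidalWindowDoorLrcModEntireJetCertDefs` (total derivative `tderiv`, chain rule, interpreter `derive`, `cert_contradiction`).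

There the derivative tables are TOTAL: every letter of the jet map must have its derivative along every used direction expressed as a
polynomial in the letters — the FINITE-TYPE situation (nsreg-p7's closure: every derivative of the 12 invariants is rational in them; with
inverse letters for the denominators).  Exact eliminations BEFORE closure (ns-poloidal-K2-p2 g6's evolution ranking, cert-1's jet schemes)
work on TRUNCATED jets: the top-order parametric letters have derivatives outside the letter set.  This file handles that case with a MASK
`M j a : Bool` («letter `a` is tabled for direction `j`»): a law may be differentiated along `j` only if every letter occurring in it
(`normalize (pderivQ a ·) ≠ []`) is tabled for `j` — a syntactic, decidable side condition enforced by the interpreter, which returns `none`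
otherwise.  The soundness hypothesis asks the table identity `D gₐ(x)(v j) = (S j a)(g x)` ONLY for tabled letters.

* `usesOnlyTabled`, `fderiv_ev_eq_ev_tderiv_masked` — the masked chain rule;
* `tderivWordM`, `combineM`, `deriveM` (all `Option`-valued), `ev_deriveM_eq_zero` — interpreter and soundness;
* `certCheckM` — ONE Boolean (`decide +kernel`) packaging «the certificate runs and its `k`-th law is the pin `T`»;
  `cert_contradictionM` — `certCheckM … = true`, hypotheses vanish on an open `U`, `T(g x₀) ≠ 0` at `x₀ ∈ U` ⇒ `False`;
* `certCheck`, `cert_contradiction'` — the same Boolean packaging for the total-table interpreter of the Defs file.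

WHAT THIS IS NOT: not a claim about Navier–Stokes and not a certificate — the checker (bears_on LADDER-NS N0, item 20428 `stub_localTHEmpty`).
References: J. F. Ritt, *Differential Algebra* (1950) Ch. I; P. J. Olver, *Applications of Lie Groups to Differential Equations* (1986) §2.3. [folklore]
-/

noncomputable section

-- the summit and its single sub-problem share the name (CONVENTIONS §1), as in every Theorems file
set_option linter.dupNamespace false

namespace Summit.NavierStokesRegularity.NavierStokesRegularity.Theorems.PoloidalWindowDoorLrcModEntireJetCertMasked

open _root_.Topology _root_.Filter Set
open Literature.Analysis.ValidatedNumerics Literature.Analysis.ValidatedNumerics.QMvPoly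
open Literature.Analysis.Calculus.MvPoly
open Summit.NavierStokesRegularity.NavierStokesRegularity.Theorems.PoloidalWindowDoorLrcModEntireJetCertDefs

variable {E : Type*} [NormedAddCommGroup E] [NormedSpace ℝ E] {n : ℕ}

/-! ### The masked chain rule -/

/-- «The term list `q` involves only letters tabled by the mask `m`»: for every letter `a < n`, either `m a` or `∂q/∂Xₐ`
normalises to the empty list. Decidable (a `Bool`). [folklore] -/
def usesOnlyTabled (n : ℕ) (m : ℕ → Bool) (q : QMvPoly) : Bool :=
  (List.range n).all fun a => m a || decide (QMvPoly.normalize (QMvPoly.pderivQ a q) = [])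

/-- Reading the mask condition letter by letter. [folklore] -/
theorem usesOnlyTabled_spec {m : ℕ → Bool} {q : QMvPoly} (h : usesOnlyTabled n m q = true) (a : Fin n)
    (ha : m a = false) : QMvPoly.toMv ℝ n (QMvPoly.pderivQ a q) = 0 := by
  have h' := List.all_eq_true.1 h a (List.mem_range.2 a.isLt)
  rw [ha, Bool.false_or, decide_eq_true_eq] at h'
  rw [← QMvPoly.toMv_normalize, h', QMvPoly.toMv_nil]

/-- **MASKED CHAIN RULE.**  If `q` involves only letters tabled by `m`, the jet map `g` is differentiable at `x`, and the table
identity `D gₐ(x) v = Sₐ(g x)` holds for the TABLED letters, then `D(q ∘ g)(x) v = (D_S q)(g x)` (the untabled letters contribute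
`0 · Sₐ` on both sides). [folklore] -/
theorem fderiv_ev_eq_ev_tderiv_masked {g : E → EuclideanSpace ℝ (Fin n)} {x v : E} {S : ℕ → QMvPoly} {m : ℕ → Bool}
    (hg : DifferentiableAt ℝ g x) (hS : ∀ i : Fin n, m i = true → fderiv ℝ (fun y => g y i) x v = ev n (S i) (g x))
    {q : QMvPoly} (hq : usesOnlyTabled n m q = true) :
    fderiv ℝ (fun y => ev n q (g y)) x v = ev n (tderiv n S q) (g x) := by
  rw [fderiv_ev_comp hg, ev, toMv_tderiv, toFun_sum]
  refine Finset.sum_congr rfl fun i _ => ?_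
  by_cases hi : m i = true
  · rw [hS i hi, toFun_mul, ev, ev, QMvPoly.toMv_pderivQ, mul_comm]
  · have h0 := usesOnlyTabled_spec hq i (by simpa using hi)
    rw [ev, h0, toFun_mul, ← QMvPoly.toMv_pderivQ, h0]
    simp

/-- Masked version of «laws vanishing on an open set have vanishing total derivatives». [folklore] -/
theorem ev_tderiv_eq_zero_masked {U : Set E} (hU : IsOpen U) {g : E → EuclideanSpace ℝ (Fin n)} {v : E} {S : ℕ → QMvPoly}
    {m : ℕ → Bool} (hg : ∀ x ∈ U, DifferentiableAt ℝ g x)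
    (hS : ∀ i : Fin n, m i = true → ∀ x ∈ U, fderiv ℝ (fun y => g y i) x v = ev n (S i) (g x))
    {L : QMvPoly} (hL : ∀ x ∈ U, ev n L (g x) = 0) (hq : usesOnlyTabled n m L = true) :
    ∀ x ∈ U, ev n (tderiv n S L) (g x) = 0 := by
  intro x hx
  rw [← fderiv_ev_eq_ev_tderiv_masked (hg x hx) (fun i hi => hS i hi x hx) hq]
  have hev : (fun y => ev n L (g y)) =ᶠ[𝓝 x] fun _ => (0 : ℝ) := by
    filter_upwards [hU.mem_nhds hx] with y hy using hL y hy
  rw [hev.fderiv_eq]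
  simp

/-! ### The masked interpreter -/

/-- Iterated total derivative along a word, checking the mask before every derivative (`none` = a law involving an untabled
letter was about to be differentiated). [folklore] -/
def tderivWordM (n : ℕ) (S : ℕ → ℕ → QMvPoly) (M : ℕ → ℕ → Bool) : List ℕ → QMvPoly → Option QMvPoly
  | [], p => some p
  | j :: w, p =>
      match tderivWordM n S M w p with
      | none => none
      | some q => if usesOnlyTabled n (M j) q then some (QMvPoly.normalize (tderiv n (S j) q)) else none

/-- Sum of a list of optional term lists (`none` if any entry is `none`). [folklore] -/
def optFlatten : List (Option QMvPoly) → Option QMvPoly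
  | [] => some []
  | none :: _ => none
  | some q :: rest =>
      match optFlatten rest with
      | none => none
      | some r => some (q ++ r)

/-- One masked certificate step. [folklore] -/
def combineM (n : ℕ) (S : ℕ → ℕ → QMvPoly) (M : ℕ → ℕ → Bool) (laws : List QMvPoly)
    (step : List (QMvPoly × ℕ × List ℕ)) : Option QMvPoly :=
  match optFlatten (step.map fun s =>
      (tderivWordM n S M s.2.2 (laws.getD s.2.1 [])).map fun q => QMvPoly.mul s.1 q) with
  | none => none
  | some r => some (QMvPoly.normalize r)

/-- The masked certificate interpreter. [folklore] -/
def deriveM (n : ℕ) (S : ℕ → ℕ → QMvPoly) (M : ℕ → ℕ → Bool) :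
    List QMvPoly → List (List (QMvPoly × ℕ × List ℕ)) → Option (List QMvPoly)
  | laws, [] => some laws
  | laws, step :: rest =>
      match combineM n S M laws step with
      | none => none
      | some L => deriveM n S M (laws ++ [L]) rest

/-- ONE BOOLEAN: the masked certificate runs and its `k`-th law is syntactically the pin `T`. [folklore] -/
def certCheckM (n : ℕ) (S : ℕ → ℕ → QMvPoly) (M : ℕ → ℕ → Bool) (hyps : List QMvPoly)
    (cert : List (List (QMvPoly × ℕ × List ℕ))) (k : ℕ) (T : QMvPoly) : Bool :=
  match deriveM n S M hyps cert with
  | none => false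
  | some laws => decide (QMvPoly.normalize (laws.getD k [] ++ QMvPoly.smul (-1) T) = [])

/-- ONE BOOLEAN for the total-table interpreter of the Defs file. [folklore] -/
def certCheck (n : ℕ) (S : ℕ → ℕ → QMvPoly) (hyps : List QMvPoly) (cert : List (List (QMvPoly × ℕ × List ℕ)))
    (k : ℕ) (T : QMvPoly) : Bool :=
  decide (QMvPoly.normalize ((derive n S hyps cert).getD k [] ++ QMvPoly.smul (-1) T) = [])

/-! ### Soundness -/

section Soundness

variable {U : Set E} {g : E → EuclideanSpace ℝ (Fin n)} {v : ℕ → E} {S : ℕ → ℕ → QMvPoly} {M : ℕ → ℕ → Bool}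

/-- Iterated masked derivatives of a vanishing law vanish. [folklore] -/
theorem ev_tderivWordM_eq_zero (hU : IsOpen U) (hg : ∀ x ∈ U, DifferentiableAt ℝ g x)
    (hS : ∀ j, ∀ i : Fin n, M j i = true → ∀ x ∈ U, fderiv ℝ (fun y => g y i) x (v j) = ev n (S j i) (g x))
    {L : QMvPoly} (hL : ∀ x ∈ U, ev n L (g x) = 0) :
    ∀ (w : List ℕ) (q : QMvPoly), tderivWordM n S M w L = some q → ∀ x ∈ U, ev n q (g x) = 0 := by
  intro w
  induction w with
  | nil =>
    intro q hq
    simp only [tderivWordM, Option.some.injEq] at hq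
    subst hq
    exact hL
  | cons j w ih =>
    intro q hq x hx
    simp only [tderivWordM] at hq
    cases hrec : tderivWordM n S M w L with
    | none => simp [hrec] at hq
    | some r =>
      simp only [hrec] at hq
      by_cases hmask : usesOnlyTabled n (M j) r = true
      · simp only [hmask, ↓reduceIte, Option.some.injEq] at hq
        subst hq
        rw [ev_normalize]
        exact ev_tderiv_eq_zero_masked hU hg (hS j) (ih r hrec) hmask x hx
      · simp [hmask] at hq

/-- The entries of `optFlatten`'s output vanish when the inputs do. [folklore] -/
theorem ev_optFlatten_eq_zero {z : EuclideanSpace ℝ (Fin n)} :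
    ∀ (L : List (Option QMvPoly)) (r : QMvPoly), optFlatten L = some r →
      (∀ q, some q ∈ L → ev n q z = 0) → ev n r z = 0 := by
  intro L
  induction L with
  | nil => intro r hr _; simp [optFlatten] at hr; subst hr; simp
  | cons o L ih =>
    intro r hr hall
    cases o with
    | none => simp [optFlatten] at hr
    | some q =>
      simp only [optFlatten] at hr
      cases hrest : optFlatten L with
      | none => simp [hrest] at hr
      | some r' =>
        simp only [hrest, Option.some.injEq] at hr
        subst hr
        rw [ev_append, hall q (by simp), ih r' hrest (fun q' hq' => hall q' (by simp [hq'])), add_zero]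

/-- A masked combination of vanishing laws vanishes. [folklore] -/
theorem ev_combineM_eq_zero (hU : IsOpen U) (hg : ∀ x ∈ U, DifferentiableAt ℝ g x)
    (hS : ∀ j, ∀ i : Fin n, M j i = true → ∀ x ∈ U, fderiv ℝ (fun y => g y i) x (v j) = ev n (S j i) (g x))
    {laws : List QMvPoly} (hlaws : ∀ L ∈ laws, ∀ x ∈ U, ev n L (g x) = 0) (step : List (QMvPoly × ℕ × List ℕ))
    {r : QMvPoly} (hr : combineM n S M laws step = some r) : ∀ x ∈ U, ev n r (g x) = 0 := by
  intro x hx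
  unfold combineM at hr
  split at hr
  · exact absurd hr (by simp)
  · rename_i r' hflat
    simp only [Option.some.injEq] at hr
    subst hr
    rw [ev_normalize]
    refine ev_optFlatten_eq_zero _ r' hflat fun q hq => ?_
    obtain ⟨s, -, hs⟩ := List.mem_map.1 hq
    obtain ⟨q', hw, rfl⟩ := Option.map_eq_some_iff.1 hs
    have hsrc : ∀ y ∈ U, ev n (laws.getD s.2.1 []) (g y) = 0 := by
      intro y hy
      rw [List.getD_eq_getElem?_getD]
      cases h : laws[s.2.1]? with
      | none => simp
      | some L => simpa using hlaws L (List.mem_of_getElem? h) y hy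
    rw [ev_mul, ev_tderivWordM_eq_zero hU hg hS hsrc s.2.2 q' hw x hx, mul_zero]

/-- **SOUNDNESS OF THE MASKED INTERPRETER**: if it succeeds, every derived law vanishes on `U`. [folklore] -/
theorem ev_deriveM_eq_zero (hU : IsOpen U) (hg : ∀ x ∈ U, DifferentiableAt ℝ g x)
    (hS : ∀ j, ∀ i : Fin n, M j i = true → ∀ x ∈ U, fderiv ℝ (fun y => g y i) x (v j) = ev n (S j i) (g x))
    (cert : List (List (QMvPoly × ℕ × List ℕ))) :
    ∀ (laws : List QMvPoly), (∀ L ∈ laws, ∀ x ∈ U, ev n L (g x) = 0) →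
      ∀ laws', deriveM n S M laws cert = some laws' → ∀ L ∈ laws', ∀ x ∈ U, ev n L (g x) = 0 := by
  induction cert with
  | nil =>
    intro laws hlaws laws' h
    simp only [deriveM, Option.some.injEq] at h
    subst h
    exact hlaws
  | cons step rest ih =>
    intro laws hlaws laws' h
    simp only [deriveM] at h
    cases hc : combineM n S M laws step with
    | none => simp [hc] at h
    | some L =>
      simp only [hc] at h
      refine ih _ (fun L' hL' => ?_) laws' h
      rcases List.mem_append.1 hL' with h' | h'
      · exact hlaws L' h'
      · rw [List.mem_singleton.1 h']
        exact ev_combineM_eq_zero hU hg hS hlaws step hc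

/-- **CONTRADICTION FROM A MASKED CERTIFICATE**: `certCheckM … = true` (decidable), all hypothesis laws vanish on the open `U`
along `g` (differentiable, tabled letters closed under the directions `v j`), and the pin `T` is non-zero at some `x₀ ∈ U`
⇒ `False`. [folklore] -/
theorem cert_contradictionM (hU : IsOpen U) (hg : ∀ x ∈ U, DifferentiableAt ℝ g x)
    (hS : ∀ j, ∀ i : Fin n, M j i = true → ∀ x ∈ U, fderiv ℝ (fun y => g y i) x (v j) = ev n (S j i) (g x))
    {hyps : List QMvPoly} (hhyps : ∀ L ∈ hyps, ∀ x ∈ U, ev n L (g x) = 0)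
    {cert : List (List (QMvPoly × ℕ × List ℕ))} {k : ℕ} {T : QMvPoly}
    (hcheck : certCheckM n S M hyps cert k T = true) {x₀ : E} (hx₀ : x₀ ∈ U) (hT : ev n T (g x₀) ≠ 0) : False := by
  apply hT
  simp only [certCheckM] at hcheck
  cases hd : deriveM n S M hyps cert with
  | none => simp [hd] at hcheck
  | some laws =>
    simp only [hd, decide_eq_true_eq] at hcheck
    have hlaw : ev n (laws.getD k []) (g x₀) = 0 := by
      rw [List.getD_eq_getElem?_getD]
      cases h : laws[k]? with
      | none => simp
      | some L => simpa using ev_deriveM_eq_zero hU hg hS cert hyps hhyps laws hd L (List.mem_of_getElem? h) x₀ hx₀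
    have hdiff : ev n (laws.getD k [] ++ QMvPoly.smul (-1) T) (g x₀) = 0 := by
      rw [← ev_normalize, hcheck, ev_nil]
    rw [ev_append, ev_smul, hlaw] at hdiff
    simpa using hdiff

/-- **CONTRADICTION FROM A TOTAL-TABLE CERTIFICATE, Boolean packaging** of the Defs file's `cert_contradiction`. [folklore] -/
theorem cert_contradiction' (hU : IsOpen U) (hg : ∀ x ∈ U, DifferentiableAt ℝ g x)
    (hS : ∀ j, ∀ x ∈ U, ∀ i : Fin n, fderiv ℝ (fun y => g y i) x (v j) = ev n (S j i) (g x))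
    {hyps : List QMvPoly} (hhyps : ∀ L ∈ hyps, ∀ x ∈ U, ev n L (g x) = 0)
    {cert : List (List (QMvPoly × ℕ × List ℕ))} {k : ℕ} {T : QMvPoly}
    (hcheck : certCheck n S hyps cert k T = true) {x₀ : E} (hx₀ : x₀ ∈ U) (hT : ev n T (g x₀) ≠ 0) : False := by
  simp only [certCheck, decide_eq_true_eq] at hcheck
  exact cert_contradiction hU hg hS hhyps cert k T hcheck hx₀ hT

end Soundness

/-! ### Self-test of the masked interpreter (`decide +kernel`)

The micro-example of the Defs file with a TRUNCATED jet: three letters `u, u′, u″` with only `u ↦ u′`, `u′ ↦ u″` tabled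
(mask `false` on `u″`); hypothesis laws `u′ − 2u = 0` and `u″ − u = 0`; step 1 differentiates the first (allowed: it involves only
`u, u′`) giving `u″ − 2u′`; step 2: `−(1/3)(law₂ − law₁ + 2·law₀) = −(1/3)(u″ − 2u′ − u″ + u + 2u′ − 4u) = u`.  -/

/-- Table of the masked micro-example. [folklore] -/
def exampleTableM : ℕ → ℕ → QMvPoly :=
  fun j a => if j = 0 then (if a = 0 then QMvPoly.var 3 1 else if a = 1 then QMvPoly.var 3 2 else []) else []

/-- Mask of the masked micro-example (`u″` untabled). [folklore] -/
def exampleMaskM : ℕ → ℕ → Bool := fun j a => decide (j = 0) && decide (a < 2)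

/-- The masked micro-example's certificate closes (kernel `decide`). [folklore] -/
theorem example_checkM :
    certCheckM 3 exampleTableM exampleMaskM
      [QMvPoly.var 3 1 ++ QMvPoly.smul (-2) (QMvPoly.var 3 0), QMvPoly.var 3 2 ++ QMvPoly.smul (-1) (QMvPoly.var 3 0)]
      [[(QMvPoly.const 1, 0, [0])],
       [(QMvPoly.const (-1/3), 2, []), (QMvPoly.const (1/3), 1, []), (QMvPoly.const (-2/3), 0, [])]]
      3 (QMvPoly.var 3 0) = true := by
  decide +kernel

/-- Differentiating a law that involves the untabled letter is refused (kernel `decide`). [folklore] -/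
theorem example_refusedM :
    certCheckM 3 exampleTableM exampleMaskM [QMvPoly.var 3 2 ++ QMvPoly.smul (-1) (QMvPoly.var 3 0)]
      [[(QMvPoly.const 1, 0, [0])]] 1 (QMvPoly.var 3 0) = false := by
  decide +kernel

end Summit.NavierStokesRegularity.NavierStokesRegularity.Theorems.PoloidalWindowDoorLrcModEntireJetCertMasked

end
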